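import Mathlib
import Summits.MatrixMultiplication.MatrixMultiplication.Theses.FieldSumsetRank
import Literature.Computability.AlgebraicComplexity.BrentEquations
import Literature.Computability.AlgebraicComplexity.MatMulTotalComplexityProofs

/-!
# MatrixMultiplication / FieldSumsetRank — support item `UpperSandwich`
(stmt-MatrixMultiplication-8738)

`R(⟨n,n,n⟩) ≤ r ⇒` the `n × n` matrix product has a POLYNOMIAL HOSTING of cost `≤ 2r − 1`:
`ℂ`-linear maps `α, β : M_n(ℂ) → ℂ[t]`, `γ : ℂ[t] → M_n(ℂ)` with `γ (α X · β Y) = X Y` and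
`dim (range α · range β) ≤ 2r − 1`.

Proof (evaluation–interpolation run backwards; Bürgisser–Clausen–Shokrollahi 1997, Prop. (14.47)
and the proof of Prop. (15.1); Bläser 2013, §4–5). Unpack `R(⟨n,n,n⟩) ≤ r` into `r` triads
(`tensorRank_le_iff`, padding), i.e. a bilinear algorithm `X Y = ∑_ρ u_ρ(X) v_ρ(Y) W_ρ`
(`sum_smul_linForm_mul_linForm_eq`). Take the `r` distinct nodes `0, 1, …, r − 1 ∈ ℂ` and let
`α X` (resp. `β Y`) be the Lagrange interpolant of the values `u_ρ(X)` (resp. `v_ρ(Y)`) at the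
nodes (`Lagrange.interpolate`), and `γ p = ∑_ρ p(ρ) · W_ρ`. Then
`γ (α X · β Y) = ∑_ρ u_ρ(X) v_ρ(Y) W_ρ = X Y`, and every product `α X · β Y` has degree
`≤ 2r − 2`, so `range α · range β ⊆ ℂ[t]_{<2r−1}`, of dimension `2r − 1` (`r = 0` forces all
products to vanish, cost `0`).
-/

set_option linter.dupNamespace false

noncomputable section

namespace Summit.MatrixMultiplication.MatrixMultiplication.Theorems

open scoped BigOperators
open Polynomial Literature.Computability.AlgebraicComplexity

/-- Degree bookkeeping: if `deg p < r` and `deg q < r` then `p · q ∈ ℂ[t]_{<2r−1}` (for `r = 0`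
the hypotheses force `p = 0`). [folklore] -/
theorem fieldSumsetRank_mul_mem_degreeLT {p q : ℂ[X]} {r : ℕ} (hp : p.degree < r)
    (hq : q.degree < r) : p * q ∈ Polynomial.degreeLT ℂ (2 * r - 1) := by
  rw [Polynomial.mem_degreeLT]
  by_cases hp0 : p = 0
  · rw [hp0, zero_mul, degree_zero]
    exact WithBot.bot_lt_coe _
  by_cases hq0 : q = 0
  · rw [hq0, mul_zero, degree_zero]
    exact WithBot.bot_lt_coe _
  have hp' : p.natDegree < r := (Polynomial.natDegree_lt_iff_degree_lt hp0).2 hp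
  have hq' : q.natDegree < r := (Polynomial.natDegree_lt_iff_degree_lt hq0).2 hq
  have hlt : (p * q).natDegree < 2 * r - 1 := by
    have hmul := Polynomial.natDegree_mul_le (p := p) (q := q)
    omega
  exact lt_of_le_of_lt Polynomial.degree_le_natDegree (by exact_mod_cast hlt)

/-- `dim ℂ[t]_{<m} = m`. [folklore] -/
theorem fieldSumsetRank_finrank_degreeLT (m : ℕ) :
    Module.finrank ℂ ↥(Polynomial.degreeLT ℂ m) = m := by
  rw [Module.finrank_eq_card_basis (Polynomial.degreeLT.basis ℂ m), Fintype.card_fin]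

/-- **Support item `UpperSandwich` of route FieldSumsetRank** (stmt-MatrixMultiplication-8738),
exact route decl: if `R(⟨n,n,n⟩) ≤ r` then `n × n` matrix multiplication over `ℂ` has a
polynomial hosting `(α, β, γ)` of cost `dim (range α · range β) ≤ 2r − 1` — interpolate a
length-`r` bilinear algorithm at `r` distinct nodes (evaluation–interpolation run backwards).
[cite: BurgisserClausenShokrollahi1997, Prop. (14.47) and proof of Prop. (15.1)]
[cite: Blaser2013, §4–5] -/
theorem upperSandwich_proof :
    Summit.MatrixMultiplication.MatrixMultiplication.Theses.FieldSumsetRank.UpperSandwich := by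
  unfold Summit.MatrixMultiplication.MatrixMultiplication.Theses.FieldSumsetRank.UpperSandwich
  intro n r hr
  classical
  obtain ⟨w, u, v, hdec⟩ := (tensorRank_le_iff (matMulTensor ℂ n n n) r).1 hr
  -- nodes `0, 1, …, r - 1`
  let node : Fin r → ℂ := fun i => ((i : ℕ) : ℂ)
  have hnode : Set.InjOn node (Finset.univ : Finset (Fin r)) :=
    (Nat.cast_injective.comp Fin.val_injective).injOn
  -- the linear forms of the algorithm, bundled
  let Lu : Matrix (Fin n) (Fin n) ℂ →ₗ[ℂ] (Fin r → ℂ) :=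
    LinearMap.pi fun ρ => ∑ ij : Fin n × Fin n, u ρ ij • Matrix.entryLinearMap ℂ ℂ ij.1 ij.2
  let Lv : Matrix (Fin n) (Fin n) ℂ →ₗ[ℂ] (Fin r → ℂ) :=
    LinearMap.pi fun ρ => ∑ jl : Fin n × Fin n, v ρ jl • Matrix.entryLinearMap ℂ ℂ jl.1 jl.2
  let W : Fin r → Matrix (Fin n) (Fin n) ℂ := fun ρ => Matrix.of fun κ ν => w ρ (κ, ν)
  let α : Matrix (Fin n) (Fin n) ℂ →ₗ[ℂ] ℂ[X] := (Lagrange.interpolate Finset.univ node) ∘ₗ Lu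
  let β : Matrix (Fin n) (Fin n) ℂ →ₗ[ℂ] ℂ[X] := (Lagrange.interpolate Finset.univ node) ∘ₗ Lv
  let γ : ℂ[X] →ₗ[ℂ] Matrix (Fin n) (Fin n) ℂ :=
    ∑ ρ : Fin r, (Polynomial.leval (node ρ)).smulRight (W ρ)
  have hLu : ∀ X ρ, Lu X ρ = ∑ ij : Fin n × Fin n, u ρ ij • X ij.1 ij.2 := by
    intro X ρ
    simp [Lu, LinearMap.pi_apply, LinearMap.sum_apply, LinearMap.smul_apply,
      Matrix.entryLinearMap_apply]
  have hLv : ∀ Y ρ, Lv Y ρ = ∑ jl : Fin n × Fin n, v ρ jl • Y jl.1 jl.2 := by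
    intro Y ρ
    simp [Lv, LinearMap.pi_apply, LinearMap.sum_apply, LinearMap.smul_apply,
      Matrix.entryLinearMap_apply]
  have hαeval : ∀ X ρ, (α X).eval (node ρ) = ∑ ij : Fin n × Fin n, u ρ ij • X ij.1 ij.2 := by
    intro X ρ
    change (Lagrange.interpolate Finset.univ node (Lu X)).eval (node ρ) = _
    rw [Lagrange.eval_interpolate_at_node _ hnode (Finset.mem_univ ρ), hLu]
  have hβeval : ∀ Y ρ, (β Y).eval (node ρ) = ∑ jl : Fin n × Fin n, v ρ jl • Y jl.1 jl.2 := by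
    intro Y ρ
    change (Lagrange.interpolate Finset.univ node (Lv Y)).eval (node ρ) = _
    rw [Lagrange.eval_interpolate_at_node _ hnode (Finset.mem_univ ρ), hLv]
  have hαdeg : ∀ X, (α X).degree < r := by
    intro X
    change (Lagrange.interpolate Finset.univ node (Lu X)).degree < _
    have h := Lagrange.degree_interpolate_lt (Lu X) hnode
    rwa [Finset.card_univ, Fintype.card_fin] at h
  have hβdeg : ∀ Y, (β Y).degree < r := by
    intro Y
    change (Lagrange.interpolate Finset.univ node (Lv Y)).degree < _
    have h := Lagrange.degree_interpolate_lt (Lv Y) hnode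
    rwa [Finset.card_univ, Fintype.card_fin] at h
  have hγ : ∀ p : ℂ[X], γ p = ∑ ρ, p.eval (node ρ) • W ρ := by
    intro p
    simp [γ, LinearMap.sum_apply, LinearMap.smulRight_apply, Polynomial.leval_apply]
  refine ⟨α, β, γ, ?_, ?_⟩
  · -- the hosting identity `γ (α X * β Y) = X * Y`
    intro X Y
    rw [hγ]
    ext κ ν
    have key := sum_smul_linForm_mul_linForm_eq (R := ℂ) hdec
      (fun ij : Fin n × Fin n => X ij.1 ij.2) (fun jl : Fin n × Fin n => Y jl.1 jl.2) κ ν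
    rw [Matrix.mul_apply, ← key, Matrix.sum_apply]
    refine Finset.sum_congr rfl fun ρ _ => ?_
    rw [Matrix.smul_apply, Polynomial.eval_mul, hαeval, hβeval]
    simp only [W, Matrix.of_apply, smul_eq_mul]
    ring
  · -- the cost bound `dim (range α * range β) ≤ 2r - 1`
    have hle : LinearMap.range α * LinearMap.range β ≤ Polynomial.degreeLT ℂ (2 * r - 1) := by
      rw [Submodule.mul_le]
      rintro p ⟨X, rfl⟩ q ⟨Y, rfl⟩
      exact fieldSumsetRank_mul_mem_degreeLT (hαdeg X) (hβdeg Y)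
    calc Module.finrank ℂ ↥(LinearMap.range α * LinearMap.range β)
        ≤ Module.finrank ℂ ↥(Polynomial.degreeLT ℂ (2 * r - 1)) := Submodule.finrank_mono hle
      _ = 2 * r - 1 := fieldSumsetRank_finrank_degreeLT _

end Summit.MatrixMultiplication.MatrixMultiplication.Theorems

end
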